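import Literature.Topology.Euclidean.PerturbedLinearZeros
import Literature.Geometry.Lorentzian.InteriorKerrGluingProofs
import HarnessLib

/-!
# Li–Mei 2020, Prop. 4.1: fixing the Kerr parameters `(m, a⃗)` (the degree step in Li–Mei's
# coordinates, and the parameter box)

Support file (all results proved; no named facts) for the named fact `LiMei.interiorKerrGluing`
(`InteriorKerrGluing.lean`; J. Li, H. Mei, *A construction of collapsing spacetimes in vacuum*,
Comm. Math. Phys. 378 (2020) = arXiv:2005.01249, Prop. 4.1). The last paragraph of the printed
proof (p. 25) reads: "`𝓘(m, a⃗) = (8π(m − m₀), −8π m₀ a⃗) + (ε₀, ε⃗) + O(ε²)` with `|(ε₀, ε⃗)| ≤ Cε`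
… we then use a degree argument … if `ε` is sufficiently small, `𝓘(m, a⃗)` has a zero in
`B_{C₀ε}`", and the zero `(m, a⃗)` is the Kerr parameter of the conclusion, with
`|m − m₀| + |a⃗| ≤ C₀ ε` (hence subextremal with `r₋ < r₀ < r₊` for `ε` small). Here:

* `obstructionLinear m₀` — the linear part `L(δm, a⃗) = (8π δm, −8π m₀ a⃗)` on `ℝ × E3`, an
  isomorphism for `m₀ ≠ 0` (`obstructionLinearEquiv`);
* `exists_parameters_zero` — **the degree step in Li–Mei's coordinates**: for `m₀ ≠ 0` and
  constants `C₁, C₂ ≥ 0` there are `C₀ ≥ 0`, `ε₁ > 0` such that for `0 ≤ ε ≤ ε₁`, every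
  `𝓘(p) = L p + e + Q(p)` with `‖e‖ ≤ C₁ε`, `Q` continuous with `‖Q‖ ≤ C₂ε²` on the ball
  `‖p‖ ≤ C₀ε`, has a zero `p = (δm, a⃗)` with `|δm| + ‖a⃗‖ ≤ 2C₀ε` (Brouwer, via
  `Brouwer.exists_zero_linear_add_of_small`, in place of the degree computation);
* `exists_parameters_zero_kerrBox` — the same with the conclusion that the zero lies in the
  parameter box of the fact: `m = m₀ + δm` and every spin `|a| ≤ ‖a⃗‖` satisfy `|a| < m`,
  `r₋(m, a) < r₀ < r₊(m, a)` (`kerrBox`, for `0 < r₀ < 2m₀`).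

## References

* J. Li, H. Mei, *A construction of collapsing spacetimes in vacuum*, Comm. Math. Phys. 378
  (2020), arXiv:2005.01249, proof of Prop. 4.1, p. 25 (key `LiMei2020`).
* T. Tao, *Hilbert's Fifth Problem and Related Topics* (2014), Thm. 6.2.1 (Brouwer) (key `Tao2014`).
-/

noncomputable section

open Metric Set Filter Topology Real

namespace Literature.Geometry.Lorentzian

namespace LiMei

/-! ### The linear part of the obstruction map -/

/-- **The linearisation of Li–Mei's obstruction map at `(m₀, 0)`**:
`L(δm, a⃗) = (8π δm, −8π m₀ a⃗)` on the parameter space `ℝ × E3` (Li–Mei, p. 25: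
"`𝓘(m, a⃗) = (8π(m − m₀), −8π m₀ a⃗) + (ε₀, ε⃗) + O(ε²)`"). [cite: LiMei2020, proof of Prop. 4.1, p. 25] -/
def obstructionLinear (m₀ : ℝ) : ℝ × E3 →L[ℝ] ℝ × E3 :=
  ((8 * π) • ContinuousLinearMap.fst ℝ ℝ E3).prod ((-(8 * π * m₀)) • ContinuousLinearMap.snd ℝ ℝ E3)

/-- `L(δm, a⃗) = (8π δm, −8π m₀ a⃗)`. [cite: LiMei2020, proof of Prop. 4.1, p. 25] -/
@[simp]
theorem obstructionLinear_apply (m₀ : ℝ) (p : ℝ × E3) :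
    obstructionLinear m₀ p = (8 * π * p.1, (-(8 * π * m₀)) • p.2) := rfl

/-- The inverse `L⁻¹(u, b⃗) = (u/(8π), −b⃗/(8π m₀))` (`m₀ ≠ 0`). [folklore] -/
def obstructionLinearInv (m₀ : ℝ) : ℝ × E3 →L[ℝ] ℝ × E3 :=
  ((8 * π)⁻¹ • ContinuousLinearMap.fst ℝ ℝ E3).prod ((-(8 * π * m₀))⁻¹ • ContinuousLinearMap.snd ℝ ℝ E3)

/-- `L⁻¹(u, b⃗) = (u/(8π), −b⃗/(8π m₀))`. [folklore] -/
@[simp]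
theorem obstructionLinearInv_apply (m₀ : ℝ) (p : ℝ × E3) :
    obstructionLinearInv m₀ p = ((8 * π)⁻¹ * p.1, (-(8 * π * m₀))⁻¹ • p.2) := rfl

/-- **`L` is an isomorphism for `m₀ ≠ 0`** (this is where `m₀ ≠ 0`, i.e. a genuine black hole, is
used in the degree step). [cite: LiMei2020, proof of Prop. 4.1, p. 25] -/
def obstructionLinearEquiv {m₀ : ℝ} (hm₀ : m₀ ≠ 0) : (ℝ × E3) ≃L[ℝ] ℝ × E3 :=
  ContinuousLinearEquiv.equivOfInverse (obstructionLinear m₀) (obstructionLinearInv m₀)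
    (fun p ↦ by
      have h8 : (8 * π) ≠ 0 := by positivity
      have h8m : (-(8 * π * m₀)) ≠ 0 := neg_ne_zero.2 (mul_ne_zero h8 hm₀)
      ext
      · simp only [obstructionLinearInv_apply, obstructionLinear_apply]
        rw [← mul_assoc, inv_mul_cancel₀ h8, one_mul]
      · simp only [obstructionLinearInv_apply, obstructionLinear_apply, smul_smul,
          inv_mul_cancel₀ h8m, one_smul])
    (fun p ↦ by
      have h8 : (8 * π) ≠ 0 := by positivity
      have h8m : (-(8 * π * m₀)) ≠ 0 := neg_ne_zero.2 (mul_ne_zero h8 hm₀)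
      ext
      · simp only [obstructionLinearInv_apply, obstructionLinear_apply]
        rw [← mul_assoc, mul_inv_cancel₀ h8, one_mul]
      · simp only [obstructionLinearInv_apply, obstructionLinear_apply, smul_smul,
          mul_inv_cancel₀ h8m, one_smul])

/-- The equivalence is `L` as a map. [folklore] -/
@[simp]
theorem coe_obstructionLinearEquiv {m₀ : ℝ} (hm₀ : m₀ ≠ 0) (p : ℝ × E3) :
    obstructionLinearEquiv hm₀ p = obstructionLinear m₀ p := rfl

/-- `|δm| + ‖a⃗‖ ≤ 2‖(δm, a⃗)‖` for the sup norm of `ℝ × E3`. [folklore] -/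
theorem abs_add_norm_le_two_mul_norm (p : ℝ × E3) : |p.1| + ‖p.2‖ ≤ 2 * ‖p‖ := by
  have h1 : |p.1| ≤ ‖p‖ := (Real.norm_eq_abs p.1).symm.le.trans (norm_fst_le p)
  have h2 : ‖p.2‖ ≤ ‖p‖ := norm_snd_le p
  linarith

/-! ### The degree step in Li–Mei's coordinates -/

/-- **Fixing the parameters (Li–Mei, p. 25, "if `ε` is sufficiently small, `𝓘(m, a⃗)` has a zero in
`B_{C₀ε}`").** Let `m₀ ≠ 0` and `C₁, C₂ ≥ 0`. There are `C₀ ≥ 0` and `ε₁ > 0` such that for every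
`0 ≤ ε ≤ ε₁`, every `e` with `‖e‖ ≤ C₁ε` and every `Q` continuous on the ball `‖p‖ ≤ C₀ε` of
`ℝ × E3` with `‖Q(p)‖ ≤ C₂ε²` there, the map `𝓘(p) = L p + e + Q(p)`,
`L(δm, a⃗) = (8π δm, −8π m₀ a⃗)`, has a zero `p = (δm, a⃗)` with `‖p‖ ≤ C₀ε`, in particular
`|δm| + ‖a⃗‖ ≤ 2C₀ε`. (Brouwer's fixed point theorem, `Brouwer.exists_zero_linear_add_of_small`,
replaces the degree computation of the printed proof.) [cite: LiMei2020, proof of Prop. 4.1, p. 25] -/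
theorem exists_parameters_zero {m₀ : ℝ} (hm₀ : m₀ ≠ 0) {C₁ C₂ : ℝ} (hC₁ : 0 ≤ C₁) (hC₂ : 0 ≤ C₂) :
    ∃ C₀ ε₁ : ℝ, 0 ≤ C₀ ∧ 0 < ε₁ ∧ ∀ ε : ℝ, 0 ≤ ε → ε ≤ ε₁ →
      ∀ e : ℝ × E3, ‖e‖ ≤ C₁ * ε →
        ∀ Q : ℝ × E3 → ℝ × E3, ContinuousOn Q (closedBall (0 : ℝ × E3) (C₀ * ε)) →
          (∀ p ∈ closedBall (0 : ℝ × E3) (C₀ * ε), ‖Q p‖ ≤ C₂ * ε ^ 2) →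
            ∃ p ∈ closedBall (0 : ℝ × E3) (C₀ * ε),
              |p.1| + ‖p.2‖ ≤ 2 * C₀ * ε ∧ obstructionLinear m₀ p + e + Q p = 0 := by
  obtain ⟨C₀, ε₁, hC₀, hε₁, H⟩ :=
    Literature.Topology.Euclidean.Brouwer.exists_zero_linear_add_of_small
      (obstructionLinearEquiv hm₀) hC₁ hC₂
  refine ⟨C₀, ε₁, hC₀, hε₁, fun ε hε hεε₁ e he Q hQc hQ ↦ ?_⟩
  obtain ⟨p, hp, hzero⟩ := H ε hε hεε₁ e he Q hQc hQ
  refine ⟨p, hp, ?_, ?_⟩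
  · have h := abs_add_norm_le_two_mul_norm p
    rw [mem_closedBall_zero_iff] at hp
    nlinarith
  · rw [coe_obstructionLinearEquiv] at hzero
    exact hzero

/-- **Fixing the parameters inside the parameter box of the fact.** For a Schwarzschild mass `m₀`
with `0 < r₀ < 2m₀` and constants `C₁, C₂ ≥ 0` there are `C₀ ≥ 0`, `ε₁ > 0` such that for
`0 ≤ ε ≤ ε₁` every obstruction map `𝓘(p) = L p + e + Q(p)` as above has a zero `(δm, a⃗)` with
`|δm| + ‖a⃗‖ ≤ 2C₀ε`, and the Kerr parameters `m = m₀ + δm`, any spin `|a| ≤ ‖a⃗‖` (in particular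
`a = ±‖a⃗‖`) are subextremal with the cylinder inside the black hole: `|a| < m`,
`r₋(m, a) < r₀ < r₊(m, a)` (`kerrBox`). This is the parameter part of the conclusion of
Li–Mei Prop. 4.1 (`|m − M| + |a| ≤ Cε`, `|a| < m`, `r₋ < r₀ < r₊`). [cite: LiMei2020, proof of Prop. 4.1, p. 25] -/
theorem exists_parameters_zero_kerrBox {m₀ r₀ : ℝ} (hr₀ : 0 < r₀) (h2m : r₀ < 2 * m₀) {C₁ C₂ : ℝ}
    (hC₁ : 0 ≤ C₁) (hC₂ : 0 ≤ C₂) :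
    ∃ C₀ ε₁ : ℝ, 0 ≤ C₀ ∧ 0 < ε₁ ∧ ∀ ε : ℝ, 0 ≤ ε → ε ≤ ε₁ →
      ∀ e : ℝ × E3, ‖e‖ ≤ C₁ * ε →
        ∀ Q : ℝ × E3 → ℝ × E3, ContinuousOn Q (closedBall (0 : ℝ × E3) (C₀ * ε)) →
          (∀ p ∈ closedBall (0 : ℝ × E3) (C₀ * ε), ‖Q p‖ ≤ C₂ * ε ^ 2) →
            ∃ p ∈ closedBall (0 : ℝ × E3) (C₀ * ε),
              obstructionLinear m₀ p + e + Q p = 0 ∧ |p.1| + ‖p.2‖ ≤ 2 * C₀ * ε ∧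
              ∀ a : ℝ, |a| ≤ ‖p.2‖ →
                |a| < m₀ + p.1 ∧ Kerr.rMinus (m₀ + p.1) a < r₀ ∧ r₀ < Kerr.rPlus (m₀ + p.1) a := by
  have hm₀ : m₀ ≠ 0 := by
    intro h
    rw [h, mul_zero] at h2m
    linarith
  obtain ⟨δ, hδ, hbox⟩ := kerrBox hr₀ h2m
  obtain ⟨C₀, ε₁, hC₀, hε₁, H⟩ := exists_parameters_zero hm₀ hC₁ hC₂
  -- shrink `ε₁` so that `2 C₀ ε ≤ δ`
  refine ⟨C₀, min ε₁ (δ / (2 * C₀ + 1)), hC₀, lt_min hε₁ (by positivity), fun ε hε hεε e he Q hQc hQ ↦ ?_⟩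
  have hε₁' : ε ≤ ε₁ := hεε.trans (min_le_left _ _)
  have hεδ : ε ≤ δ / (2 * C₀ + 1) := hεε.trans (min_le_right _ _)
  obtain ⟨p, hp, hsum, hzero⟩ := H ε hε hε₁' e he Q hQc hQ
  refine ⟨p, hp, hzero, hsum, fun a ha ↦ hbox (m₀ + p.1) a ?_⟩
  have h2C : 2 * C₀ * ε ≤ δ := by
    have h1 : 2 * C₀ * ε ≤ (2 * C₀ + 1) * ε := by nlinarith
    have h2 : (2 * C₀ + 1) * ε ≤ δ := by
      rw [le_div_iff₀ (by positivity)] at hεδ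
      linarith
    linarith
  calc |m₀ + p.1 - m₀| + |a| = |p.1| + |a| := by rw [add_sub_cancel_left]
    _ ≤ |p.1| + ‖p.2‖ := by linarith
    _ ≤ δ := hsum.trans h2C

end LiMei

end Literature.Geometry.Lorentzian

end
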